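import Mathlib
import Summits.QuantumAdvantage.QuantumAdvantage.Theorems.MobiusLadderQuadraticDigitPhasesStubCompactLemmas
import Summits.QuantumAdvantage.QuantumAdvantage.Theorems.MobiusLadderQuadraticDigitPhasesStubCompactLemmas2

/-!
# One cut of high rank — lemmas I: digits, carry classes, blocks, the cut

Helper file for the stub `stub_oneCutKatai` of the crux `MobiusLadder.QuadraticDigitPhases`
(stmt-QuantumAdvantage-1391), line `Sketch`.

Elementary bookkeeping for the one-cut Cauchy–Schwarz argument (all folklore):
* `testBit_mul_block` — the binary digits of `p (2^c T + T₀)`: below `c` those of `p T₀`, from `c`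
  on those of `p T + ⌊p T₀ / 2^c⌋` (the carry);
* `eq_of_testBit_mul_add_eq` — for odd `p`, `T ↦ (p T + κ) mod 2^d` is injective on `[0, 2^d)`;
* `carryClass_eq_Ico` — the carry classes `{T₀ < L : (⌊pT₀/N⌋, ⌊qT₀/N⌋) = κ}` are intervals;
* `abs_sum_Icc_le_blocks` — cutting `[1, M]` into aligned blocks of length `L` costs `≤ L + 1`
  (via `sum_range_mul_block` of the compactness lemmas);
* `exists_pow_le_two_pow` — `(w r + 1)^w ≤ η 2^r` for all large `r`;
* `rank_padded_le` — the zero-padded cut matrix has rank `≤` that of its `c × d` block;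
* `eval_split` — on idempotent vectors a quadratic `P` splits along the cut as
  `P₀(x_{<c}) + P₁(x_{≥c}) + x_{<c}ᵀ Bc x_{≥c}` (from the normal form of the compactness lemmas).
-/

set_option linter.dupNamespace false -- D-0017: single-problem summit ⇒ QuantumAdvantage.QuantumAdvantage by design

namespace Summit.QuantumAdvantage.QuantumAdvantage.Theorems.MobiusLadderQuadraticDigitPhasesStubOneCutKatai

open Finset

/-! ## Binary digits of `p · (2^c T + T₀)` -/

/-- `p (2^c T + T₀) = 2^c (p T + ⌊p T₀ / 2^c⌋) + (p T₀ mod 2^c)`. -/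
theorem mul_block_eq (p c T T₀ : ℕ) :
    p * (2 ^ c * T + T₀) = 2 ^ c * (p * T + p * T₀ / 2 ^ c) + p * T₀ % 2 ^ c := by
  have h := Nat.div_add_mod (p * T₀) (2 ^ c)
  have : p * (2 ^ c * T + T₀) = 2 ^ c * (p * T) + p * T₀ := by ring
  rw [this, mul_add, add_assoc, h]

/-- The digits of `p (2^c T + T₀)`: below `c` those of `p T₀`, from `c` on those of `p T + ⌊p T₀/2^c⌋`. -/
theorem testBit_mul_block (p c T T₀ i : ℕ) :
    Nat.testBit (p * (2 ^ c * T + T₀)) i =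
      if i < c then Nat.testBit (p * T₀) i else Nat.testBit (p * T + p * T₀ / 2 ^ c) (i - c) := by
  rw [mul_block_eq, Nat.testBit_two_pow_mul_add _ (Nat.mod_lt _ (by positivity))]
  split_ifs with h
  · rw [Nat.testBit_mod_two_pow]
    simp [h]
  · rfl

/-- Injectivity of `T ↦ (digits below d of p T + κ)` on `[0, 2^d)` for odd `p`. -/
theorem eq_of_testBit_mul_add_eq {p d κ T T' : ℕ} (hp : Odd p) (hT : T < 2 ^ d) (hT' : T' < 2 ^ d)
    (h : ∀ k < d, Nat.testBit (p * T + κ) k = Nat.testBit (p * T' + κ) k) : T = T' := by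
  have hmod : (p * T + κ) % 2 ^ d = (p * T' + κ) % 2 ^ d := by
    apply Nat.eq_of_testBit_eq
    intro i
    rw [Nat.testBit_mod_two_pow, Nat.testBit_mod_two_pow]
    by_cases hi : i < d
    · simp [hi, h i hi]
    · simp [hi]
  have h1 : p * T ≡ p * T' [MOD 2 ^ d] := Nat.ModEq.add_right_cancel' κ hmod
  have hcop : Nat.gcd (2 ^ d) p = 1 := (Nat.coprime_two_left.mpr hp).pow_left d
  have h2 : T ≡ T' [MOD 2 ^ d] := Nat.ModEq.cancel_left_of_coprime hcop h1
  have h3 : T % 2 ^ d = T' % 2 ^ d := h2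
  rwa [Nat.mod_eq_of_lt hT, Nat.mod_eq_of_lt hT'] at h3

/-! ## Order-convex sets of naturals are intervals -/

/-- A finite order-convex set of naturals inside `[0, L)` is an interval `[a, b)` with `b ≤ L`. -/
theorem exists_eq_Ico_of_convex (s : Finset ℕ) (L : ℕ) (hsL : ∀ x ∈ s, x < L)
    (hconv : ∀ x ∈ s, ∀ z ∈ s, ∀ y, x ≤ y → y ≤ z → y ∈ s) :
    ∃ a b : ℕ, b ≤ L ∧ s = Ico a b := by
  rcases s.eq_empty_or_nonempty with rfl | hne
  · exact ⟨0, 0, Nat.zero_le _, by simp⟩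
  · refine ⟨s.min' hne, s.max' hne + 1, hsL _ (s.max'_mem hne), ?_⟩
    ext y
    simp only [Finset.mem_Ico]
    constructor
    · intro hy
      exact ⟨s.min'_le y hy, Nat.lt_succ_of_le (s.le_max' y hy)⟩
    · rintro ⟨h1, h2⟩
      exact hconv _ (s.min'_mem hne) _ (s.max'_mem hne) y h1 (Nat.le_of_lt_succ h2)

/-- The carry classes `{T₀ < L : (⌊p T₀/N⌋, ⌊q T₀/N⌋) = κ}` are intervals `[a, b)`, `b ≤ L`. -/
theorem carryClass_eq_Ico (p q N L : ℕ) (κ : ℕ × ℕ) :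
    ∃ a b : ℕ, b ≤ L ∧
      (range L).filter (fun T₀ => (p * T₀ / N, q * T₀ / N) = κ) = Ico a b := by
  obtain ⟨k₁, k₂⟩ := κ
  refine exists_eq_Ico_of_convex _ L (fun x hx => by simpa using (Finset.mem_filter.mp hx).1) ?_
  intro x hx z hz y hxy hyz
  simp only [Finset.mem_filter, Finset.mem_range, Prod.mk.injEq] at hx hz ⊢
  obtain ⟨-, hx1, hx2⟩ := hx
  obtain ⟨hzL, hz1, hz2⟩ := hz
  refine ⟨lt_of_le_of_lt hyz hzL, le_antisymm ?_ ?_, le_antisymm ?_ ?_⟩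
  · exact hz1 ▸ Nat.div_le_div_right (Nat.mul_le_mul_left p hyz)
  · exact hx1 ▸ Nat.div_le_div_right (Nat.mul_le_mul_left p hxy)
  · exact hz2 ▸ Nat.div_le_div_right (Nat.mul_le_mul_left q hyz)
  · exact hx2 ▸ Nat.div_le_div_right (Nat.mul_le_mul_left q hxy)

/-! ## Blocks of `[1, M]` -/

/-- Cutting `[1, M]` into the aligned blocks of length `L` below `L ⌊M/L⌋` costs at most `L + 1`
for a `1`-bounded summand. -/
theorem abs_sum_Icc_le_blocks (F : ℕ → ℝ) (hF : ∀ m, |F m| ≤ 1) {L : ℕ} (hL : 0 < L) (M : ℕ) :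
    |∑ m ∈ Icc 1 M, F m| ≤
      |∑ T ∈ range (M / L), ∑ T₀ ∈ range L, F (L * T + T₀)| + L + 1 := by
  have hsplit : ∑ m ∈ range (M + 1), F m = F 0 + ∑ m ∈ Icc 1 M, F m := by
    rw [Finset.range_eq_Ico, ← Finset.Ico_add_one_right_eq_Icc]
    have h01 : (1 : ℕ) ≤ M + 1 := by omega
    rw [← Finset.sum_Ico_consecutive F (Nat.zero_le 1) h01]
    simp
  have hle : L * (M / L) ≤ M + 1 := (Nat.mul_div_le M L).trans (Nat.le_succ M)
  have hsplit2 := Finset.sum_range_add_sum_Ico F hle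
  rw [MobiusLadderQuadraticDigitPhasesStubCompact.sum_range_mul_block]
  have htail : |∑ k ∈ Ico (L * (M / L)) (M + 1), F k| ≤ L := by
    refine (Finset.abs_sum_le_sum_abs _ _).trans ?_
    refine (Finset.sum_le_sum fun i _ => hF i).trans ?_
    simp only [Finset.sum_const, Nat.card_Ico, nsmul_eq_mul, mul_one]
    have h1 : M + 1 - L * (M / L) ≤ L := by
      have h2 := Nat.div_add_mod M L
      have h3 := Nat.mod_lt M hL
      omega
    exact_mod_cast h1
  have hF0 : |F 0| ≤ 1 := hF 0
  have heq : ∑ m ∈ Icc 1 M, F m =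
      ∑ k ∈ range (L * (M / L)), F k + ∑ k ∈ Ico (L * (M / L)) (M + 1), F k - F 0 := by
    rw [hsplit2, hsplit]; ring
  rw [heq]
  have h1 := abs_sub (∑ k ∈ range (L * (M / L)), F k + ∑ k ∈ Ico (L * (M / L)) (M + 1), F k) (F 0)
  have h2 := abs_add_le (∑ k ∈ range (L * (M / L)), F k) (∑ k ∈ Ico (L * (M / L)) (M + 1), F k)
  linarith

/-! ## Polynomial versus exponential -/

/-- For every `w` and `η > 0`: `(w r + 1)^w ≤ η 2^r` for all large `r`. -/
theorem exists_pow_le_two_pow (w : ℕ) {η : ℝ} (hη : 0 < η) :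
    ∃ R₁ : ℕ, ∀ r : ℕ, R₁ ≤ r → ((w * r + 1 : ℕ) : ℝ) ^ w ≤ η * (2 : ℝ) ^ r := by
  have hlim := tendsto_pow_const_div_const_pow_of_one_lt w (one_lt_two (α := ℝ))
  have hpos : (0 : ℝ) < η / ((w : ℝ) + 1) ^ w := by positivity
  obtain ⟨R₁, hR₁⟩ := Filter.eventually_atTop.mp (hlim.eventually_lt_const hpos)
  refine ⟨max R₁ 1, fun r hr => ?_⟩
  have hr1 : R₁ ≤ r := le_of_max_le_left hr
  have hr2 : (1 : ℝ) ≤ r := by exact_mod_cast le_of_max_le_right hr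
  have h2r : (0 : ℝ) < (2 : ℝ) ^ r := by positivity
  have hw1 : (0 : ℝ) < ((w : ℝ) + 1) ^ w := by positivity
  have key : ((r : ℝ) ^ w / (2 : ℝ) ^ r) < η / ((w : ℝ) + 1) ^ w := hR₁ r hr1
  rw [div_lt_div_iff₀ h2r hw1] at key
  have hle : ((w * r + 1 : ℕ) : ℝ) ≤ ((w : ℝ) + 1) * r := by push_cast; nlinarith
  calc ((w * r + 1 : ℕ) : ℝ) ^ w ≤ (((w : ℝ) + 1) * r) ^ w :=
        pow_le_pow_left₀ (by positivity) hle w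
    _ = (r : ℝ) ^ w * ((w : ℝ) + 1) ^ w := by rw [mul_pow, mul_comm]
    _ ≤ η * (2 : ℝ) ^ r := key.le

/-! ## The cut: rank of the padded matrix, and the split of a quadratic polynomial -/

/-- The padded cut matrix `(𝟙[i < c ≤ j] a i j)_{i,j < c+d}` has rank at most that of its
`c × d` block `(a i (c + k))_{i<c, k<d}`. -/
theorem rank_padded_le (c d : ℕ) (a : Fin (c + d) → Fin (c + d) → ZMod 2)
    (Bc : Matrix (Fin c) (Fin d) (ZMod 2))
    (hBc : ∀ i k, Bc i k = a (Fin.castAdd d i) (Fin.natAdd c k)) :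
    (Matrix.of fun i j : Fin (c + d) => if (i : ℕ) < c ∧ c ≤ (j : ℕ) then a i j else 0).rank ≤
      Bc.rank := by
  set E : Matrix (Fin (c + d)) (Fin c) (ZMod 2) :=
    Matrix.of fun j i => if j = Fin.castAdd d i then 1 else 0 with hE
  set F : Matrix (Fin d) (Fin (c + d)) (ZMod 2) :=
    Matrix.of fun k j => if j = Fin.natAdd c k then 1 else 0 with hF
  have hEB : ∀ (j : Fin (c + d)) (k : Fin d), (E * Bc) j k =
      Fin.addCases (fun i => Bc i k) (fun _ => 0) j := by
    intro j k
    simp only [Matrix.mul_apply, hE, Matrix.of_apply]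
    induction j using Fin.addCases with
    | left i₀ =>
      simp only [Fin.addCases_left]
      rw [Finset.sum_eq_single i₀]
      · simp
      · intro i _ hi
        have : Fin.castAdd d i₀ ≠ Fin.castAdd d i := fun h => hi (Fin.castAdd_inj.mp h).symm
        simp [this]
      · simp
    | right k₀ =>
      simp only [Fin.addCases_right]
      refine Finset.sum_eq_zero fun i _ => ?_
      have : Fin.natAdd c k₀ ≠ Fin.castAdd d i := by
        intro h
        have := congrArg Fin.val h
        simp at this
        omega
      simp [this]
  have key : (Matrix.of fun i j : Fin (c + d) => if (i : ℕ) < c ∧ c ≤ (j : ℕ) then a i j else 0) =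
      E * Bc * F := by
    ext j j'
    simp only [Matrix.mul_apply, hEB, hF, Matrix.of_apply]
    induction j' using Fin.addCases with
    | left i₁ =>
      have hcond : ¬ ((j : ℕ) < c ∧ c ≤ ((Fin.castAdd d i₁ : Fin (c + d)) : ℕ)) := by
        simp
      rw [if_neg hcond]
      symm
      refine Finset.sum_eq_zero fun k _ => ?_
      have : Fin.castAdd d i₁ ≠ Fin.natAdd c k := by
        intro h
        have := congrArg Fin.val h
        simp at this
        omega
      simp [this]
    | right k₁ =>
      rw [Finset.sum_eq_single k₁]
      · simp only [if_true]
        induction j using Fin.addCases with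
        | left i₀ => simp [hBc]
        | right k₀ => simp
      · intro k _ hk
        have : Fin.natAdd c k₁ ≠ Fin.natAdd c k := by
          intro h
          have h' := congrArg Fin.val h
          simp only [Fin.val_natAdd] at h'
          exact hk (Fin.ext (by omega)).symm
        simp [this]
      · simp
  rw [key]
  exact (Matrix.rank_mul_le_left _ _).trans (Matrix.rank_mul_le_right _ _)

/-- THE SPLIT of a quadratic polynomial along the cut `c | d` on idempotent vectors:
`P(x) = P₀(x_{<c}) + P₁(x_{≥c}) + x_{<c}ᵀ · Bc · x_{≥c}` with `Bc` the block of cross coefficients. -/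
theorem eval_split {c d : ℕ} (P : MvPolynomial (Fin (c + d)) (ZMod 2)) (hP : P.totalDegree ≤ 2)
    (Bc : Matrix (Fin c) (Fin d) (ZMod 2))
    (hBc : ∀ i k, Bc i k = MvPolynomial.coeff
      (Finsupp.single (Fin.castAdd d i) 1 + Finsupp.single (Fin.natAdd c k) 1) P) :
    ∃ (P₀ : (Fin c → ZMod 2) → ZMod 2) (P₁ : (Fin d → ZMod 2) → ZMod 2),
      ∀ x : Fin (c + d) → ZMod 2, (∀ i, x i * x i = x i) →
        MvPolynomial.eval x P = P₀ (fun i => x (Fin.castAdd d i)) + P₁ (fun k => x (Fin.natAdd c k)) +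
          ∑ i : Fin c, x (Fin.castAdd d i) * (Bc.mulVec (fun k => x (Fin.natAdd c k))) i := by
  refine ⟨fun y => MvPolynomial.coeff 0 P +
      ((∑ i : Fin c, ∑ j : Fin c, (if i < j then MvPolynomial.coeff
          (Finsupp.single (Fin.castAdd d i) 1 + Finsupp.single (Fin.castAdd d j) 1) P else 0) *
            y i * y j) +
        ∑ i : Fin c, (MvPolynomial.coeff (Finsupp.single (Fin.castAdd d i) 1) P +
          MvPolynomial.coeff (Finsupp.single (Fin.castAdd d i) 2) P) * y i),
    fun z => (∑ i : Fin d, ∑ j : Fin d, (if i < j then MvPolynomial.coeff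
          (Finsupp.single (Fin.natAdd c i) 1 + Finsupp.single (Fin.natAdd c j) 1) P else 0) *
            z i * z j) +
        ∑ i : Fin d, (MvPolynomial.coeff (Finsupp.single (Fin.natAdd c i) 1) P +
          MvPolynomial.coeff (Finsupp.single (Fin.natAdd c i) 2) P) * z i, ?_⟩
  intro x hx
  rw [MobiusLadderQuadraticDigitPhasesStubCompact.eval_eq_of_totalDegree_le_two P hP x hx]
  have h1 : ∀ (i : Fin c) (j : Fin d), Fin.castAdd d i < Fin.natAdd c j := by
    intro i j
    rw [Fin.lt_def]
    simp
    omega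
  have h2 : ∀ (i : Fin d) (j : Fin c), ¬ (Fin.natAdd c i < Fin.castAdd d j) := by
    intro i j
    rw [Fin.lt_def]
    simp
    omega
  have h3 : ∀ i j : Fin c, Fin.castAdd d i < Fin.castAdd d j ↔ i < j := by
    intro i j
    rw [Fin.lt_def, Fin.lt_def]
    simp
  have h4 : ∀ i j : Fin d, Fin.natAdd c i < Fin.natAdd c j ↔ i < j := by
    intro i j
    rw [Fin.lt_def, Fin.lt_def]
    simp
  have hcross : ∑ i : Fin c, x (Fin.castAdd d i) * (Bc.mulVec (fun k => x (Fin.natAdd c k))) i =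
      ∑ i : Fin c, ∑ j : Fin d, MvPolynomial.coeff
          (Finsupp.single (Fin.castAdd d i) 1 + Finsupp.single (Fin.natAdd c j) 1) P *
            x (Fin.castAdd d i) * x (Fin.natAdd c j) := by
    refine Finset.sum_congr rfl fun i _ => ?_
    simp only [Matrix.mulVec, dotProduct, Finset.mul_sum]
    refine Finset.sum_congr rfl fun j _ => ?_
    rw [hBc]
    ring
  rw [hcross]
  simp only [Fin.sum_univ_add]
  simp only [Finset.sum_add_distrib, h1, h2, if_true, if_false, zero_mul, Finset.sum_const_zero,
    zero_add, h3, h4]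
  ring

end Summit.QuantumAdvantage.QuantumAdvantage.Theorems.MobiusLadderQuadraticDigitPhasesStubOneCutKatai
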